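import Mathlib

/-!
# Super-logarithmic volumes of the explicit sign-anchored regularisation

Analysis stub `stub_superLog` of the line `Ideator3Sketch` for the crux `ChiralMobilityGap`
(stmt-QuantumFields-17497).  The explicit Wilson-QCD regularisation `anchorReg` has lattice
spacings `a_k = 1/(k+2)` and torus half-sides `L_k = (k+2)·⌈log(k+2)⌉₊²`, so the physical side is
`a_k L_k = ⌈log(k+2)⌉₊²`.  The landed `N_f = 3` pin lemma needs SUPER-LOGARITHMIC volumes,
`a_k L_k / log(L_k + 2) → ∞`; this file proves exactly that statement for the explicit data, fully
unfolded (pure real analysis, no project definitions).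

Proof: with `x = k + 2 ≥ 2` and `c = ⌈log x⌉₊`, the numerator is `c²`, and `log x ≤ c ≤ log x + 1 ≤ x`
gives `x c² + 2 ≤ x³ + 2 ≤ x⁴`, so the denominator is at most `4 log x`; hence the quotient is at
least `log² x / (4 log x) = log x / 4 → ∞`.
-/

noncomputable section

namespace Summit.QuantumFields.QCD.Theorems.ChiralMobilityGapAnchor

open Filter
open scoped Topology

/-- **Super-logarithmic volumes of the explicit data**:
`a_k L_k / log(L_k + 2) → ∞` for `a_k = 1/(k+2)`, `L_k = (k+2)⌈log(k+2)⌉₊²`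
(numerator `= ⌈log(k+2)⌉₊² ≥ log²(k+2)`, denominator `≤ 4 log(k+2)`). -/
theorem stub_superLog :
    Tendsto (fun k : ℕ => (1 / ((k : ℝ) + 2)) * (((k + 2) * ⌈Real.log ((k : ℝ) + 2)⌉₊ ^ 2 : ℕ) : ℝ) /
      Real.log ((((k + 2) * ⌈Real.log ((k : ℝ) + 2)⌉₊ ^ 2 : ℕ) : ℝ) + 2)) atTop atTop := by
  have hlog : Tendsto (fun k : ℕ => Real.log ((k : ℝ) + 2) / 4) atTop atTop :=
    (Real.tendsto_log_atTop.comp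
      (tendsto_natCast_atTop_atTop.atTop_add tendsto_const_nhds)).atTop_div_const (by norm_num)
  refine tendsto_atTop_mono (fun k => ?_) hlog
  push_cast
  set x : ℝ := (k : ℝ) + 2 with hx_def
  set c : ℕ := ⌈Real.log x⌉₊ with hc_def
  have hx2 : (2 : ℝ) ≤ x := by simp [hx_def]
  have hx0 : 0 < x := by linarith
  have hlog0 : 0 < Real.log x := Real.log_pos (by linarith)
  have hc_ge : Real.log x ≤ (c : ℝ) := Nat.le_ceil _
  have hc_le : (c : ℝ) ≤ x := by
    have h1 : (c : ℝ) < Real.log x + 1 := Nat.ceil_lt_add_one hlog0.le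
    have h2 : Real.log x ≤ x - 1 := Real.log_le_sub_one_of_pos hx0
    linarith
  have hnum : 1 / x * (x * (c : ℝ) ^ 2) = (c : ℝ) ^ 2 := by
    field_simp
  rw [hnum]
  have harg : 1 < x * (c : ℝ) ^ 2 + 2 := by
    have : 0 ≤ x * (c : ℝ) ^ 2 := by positivity
    linarith
  have hD_pos : 0 < Real.log (x * (c : ℝ) ^ 2 + 2) := Real.log_pos harg
  have hpow : Real.log (x ^ 4) = 4 * Real.log x := by
    rw [Real.log_pow]; norm_num
  have hD_le : Real.log (x * (c : ℝ) ^ 2 + 2) ≤ 4 * Real.log x := by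
    rw [← hpow]
    apply Real.log_le_log (by linarith)
    calc x * (c : ℝ) ^ 2 + 2 ≤ x * x ^ 2 + 2 := by gcongr
      _ ≤ x ^ 4 := by nlinarith [pow_le_pow_left₀ (by norm_num : (0 : ℝ) ≤ 2) hx2 3]
  rw [le_div_iff₀ hD_pos]
  calc Real.log x / 4 * Real.log (x * (c : ℝ) ^ 2 + 2)
      ≤ Real.log x / 4 * (4 * Real.log x) := by gcongr
    _ = Real.log x ^ 2 := by ring
    _ ≤ (c : ℝ) ^ 2 := by gcongr

end Summit.QuantumFields.QCD.Theorems.ChiralMobilityGapAnchor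

end
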